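import Mathlib

/-!
# The pairing lemma: a sign-reversing involution that does not decrease `g` on the positive
side (blind cell PercRepro2, p3 g28, 2026-08-28; `proofs/P3-PENDANT.md` §6, CLASS C6)

On a finite set `L` closed under an involution `ψ` with `f (ψ x) = -f x`, if `g x ≤ g (ψ x)`
whenever `f x > 0`, then `∑_{x ∈ L} g x * f x ≤ 0` (`sum_mul_nonpos_of_involution`):
`2 ∑ g f = ∑ (g f + (g f) ∘ ψ) = ∑ f · (g − g ∘ ψ)` and every term is `≤ 0`.  The instance
of CLASS C6 of the single-`d` statement: `L` the legal states, `ψ` the switch of the only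
linking block (not joined to `d`, attached to marks only, `d` not linking), `f = σ_rs = ±1`
negated by the switch, `g = σ_pq` non-decreasing along the switch from the `Y` side to the
`W` side (the block becomes a `Y`-connector and stops being a `W`-connector).  No
definitions.  Own work; std axioms.
-/

namespace Summit.Ventures.PercRepro2

namespace M9Reduce

open Finset

/-- **The pairing lemma.** -/
theorem sum_mul_nonpos_of_involution {α : Type*} [DecidableEq α] (L : Finset α) (ψ : α → α)
    (hψ : ∀ x, ψ (ψ x) = x) (hL : ∀ x ∈ L, ψ x ∈ L) (f g : α → ℤ)
    (hf : ∀ x, f (ψ x) = -f x) (hg : ∀ x ∈ L, 0 < f x → g x ≤ g (ψ x)) :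
    ∑ x ∈ L, g x * f x ≤ 0 := by
  -- reindex the sum by the involution
  have hre : ∑ x ∈ L, g (ψ x) * f (ψ x) = ∑ x ∈ L, g x * f x :=
    Finset.sum_nbij' ψ ψ (fun x hx => hL x hx) (fun x hx => hL x hx) (fun x _ => hψ x)
      (fun x _ => hψ x) (fun x _ => rfl)
  have h2 : 2 * ∑ x ∈ L, g x * f x = ∑ x ∈ L, f x * (g x - g (ψ x)) := by
    have : ∀ x, f x * (g x - g (ψ x)) = g x * f x + g (ψ x) * f (ψ x) := fun x => by
      rw [hf x]; ring
    simp_rw [this]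
    rw [Finset.sum_add_distrib, hre]; ring
  have hterm : ∀ x ∈ L, f x * (g x - g (ψ x)) ≤ 0 := by
    intro x hx
    rcases lt_trichotomy (f x) 0 with hneg | hzero | hpos
    · -- `f x < 0`: apply the hypothesis at `ψ x`
      have h1 : 0 < f (ψ x) := by rw [hf x]; linarith
      have h2 := hg (ψ x) (hL x hx) h1
      rw [hψ x] at h2
      nlinarith
    · rw [hzero]; simp
    · have := hg x hx hpos
      nlinarith
  have : ∑ x ∈ L, f x * (g x - g (ψ x)) ≤ 0 := Finset.sum_nonpos hterm
  linarith

end M9Reduce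

end Summit.Ventures.PercRepro2
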